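import Literature.NumberTheory.LFunctions.FeketePolyaKernelCertificatesBlockWrappers
import HarnessLib

/-!
# No real zero for real primitive characters of conductor `14323 ≤ q ≤ 15059`: the Fekete–Pólya rows, in the kernel (rows deferred by the earlier engines)

Topic `Literature/NumberTheory/LFunctions`; namespace `Literature.NumberTheory.LFunctions`. THEOREMS only (no
definition, no named fact, no `sorry`; standard axioms): one PUBLIC theorem **`noRealZero{Odd,Even}_fp_<q>`** per
fundamental discriminant `D`, `|D| = q ∈ [14323, 15059]`, that admits a Fekete–Pólya witness but was DEFERRED by the per-position engines v1/v2 (walk too long for one `decide`) — for every primitive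
quadratic `χ` mod `q` of the parity of `D` and every `σ ∈ (0, 1)`, `L(σ, χ) ≠ 0` (statement shape of the
`interval_cases` bullets of the `NoRealZero{Odd,Even}…` range files, so a range assembly cites them by name).
Cell `parity-realchar`, kernel floor of the wide column (TARGET §2 row 19), Fekete–Pólya lane (seat prover-2).

Method (engine v4): `FeketePolyaKernelCertificatesBlock{,Wrappers}.lean` — the iterated partial sums of order
`K` of the induced character `χ↑(q·w)` are non-negative over one period, decided in the kernel BLOCKWISE on packed
base-`2^b` digits (`blockCert b B K (q·w) (tabs… b ps q w)`: sign tables of the character from the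
quadratic-residue bitsets of the prime factors of the conductor — the factor list is part of each certificate,
primality by `norm_num` — prefix sums by one big-integer multiplication per order and block, sign test by one
AND), hence `ℜL(σ, χ↑(q·w)) > 0` (Fekete–Pólya 1912 / MV §11.2.1 Exercise 7) and `L(σ, χ) ≠ 0` (positive Euler
factors, Exercise 8).  Witnesses `(w, K)` = the cheapest in the exact integer scan of this seat
(`HOME/parity-realchar-prover-2/fp-witnesses-*.tsv`; no kit); the digit width `b` is two bits above the size of
the running-sum bound recorded by the scan.  17 characters in this file (est. 79 kernel-s).
NOT covered here (no Fekete–Pólya witness with `w ≤ 40`, `q·w ≤ 4·10⁵`, `K ≤ 12`; the other Fekete–Pólya rows of this range are in the `NoRealZeroFeketePolyaX…` files) — left to the truncation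
certificates of the companion lane: see those files.

## References

* H. L. Montgomery, R. C. Vaughan, *Multiplicative Number Theory I*, CUP 2007, §9.3 Thm 9.13, §11.2.1
  Exercises 7–8. [MontgomeryVaughan2007]
* M. Fekete, G. Pólya, *Über ein Problem von Laguerre*, Rend. Circ. Mat. Palermo 34 (1912) 89–120. [FeketePolya1912]
-/

namespace Literature.NumberTheory.LFunctions

open FeketePolyaKernel

set_option maxHeartbeats 400000 in
/-- `D = -14323`: the odd character `(·/14323)` of conductor `14323` (`14323`: prime) — Fekete–Pólya witness of order `7` along the induced modulus `14323·15 = 214845`, block certificate (digits of `105` bits, splitting depth `10`); est. `8.6` kernel-s. [cite: MontgomeryVaughan2007, §11.2.1 Exercises 7 (g), 8] -/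
theorem noRealZeroOdd_fp_14323 :
    ∀ χ : DirichletCharacter ℂ 14323, χ.IsQuadratic → χ.IsPrimitive → χ.Odd →
      ∀ σ : ℝ, 0 < σ → σ < 1 → χ.LFunction σ ≠ 0 :=
  good_odd_of_odd_blk [14323] (by norm_num) (by decide) (by decide) 15 7 105 10 (by decide) (by decide) (by decide)
    (Or.inr (by decide +kernel))

set_option maxHeartbeats 400000 in
/-- `D = 14341`: the even character `(·/14341)` of conductor `14341` (`14341`: prime) — Fekete–Pólya witness of order `8` along the induced modulus `14341·11 = 157751`, block certificate (digits of `115` bits, splitting depth `10`); est. `7.6` kernel-s. [cite: MontgomeryVaughan2007, §11.2.1 Exercises 7 (g), 8] -/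
theorem noRealZeroEven_fp_14341 :
    ∀ χ : DirichletCharacter ℂ 14341, χ.IsQuadratic → χ.IsPrimitive → χ.Even →
      ∀ σ : ℝ, 0 < σ → σ < 1 → χ.LFunction σ ≠ 0 :=
  good_even_of_odd_blk [14341] (by norm_num) (by decide) (by decide) 11 8 115 10 (by decide) (by decide) (by decide)
    (Or.inr (by decide +kernel))

set_option maxHeartbeats 400000 in
/-- `D = 14385`: the even character `(·/14385)` of conductor `14385` (`14385`: 3 · 5 · 7 · 137) — Fekete–Pólya witness of order `2` along the induced modulus `14385·11 = 158235`, block certificate (digits of `24` bits, splitting depth `8`); est. `0.8` kernel-s. [cite: MontgomeryVaughan2007, §11.2.1 Exercises 7 (g), 8] -/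
theorem noRealZeroEven_fp_14385 :
    ∀ χ : DirichletCharacter ℂ 14385, χ.IsQuadratic → χ.IsPrimitive → χ.Even →
      ∀ σ : ℝ, 0 < σ → σ < 1 → χ.LFunction σ ≠ 0 :=
  good_even_of_odd_blk [3, 5, 7, 137] (by norm_num) (by decide) (by decide) 11 2 24 8 (by decide) (by decide) (by decide)
    (Or.inr (by decide +kernel))

set_option maxHeartbeats 400000 in
/-- `D = -14392`: the odd character `χ₈·(·/1799)` of conductor `14392` (`1799`: 7 · 257) — Fekete–Pólya witness of order `3` along the induced modulus `14392·15 = 215880`, block certificate (digits of `44` bits, splitting depth `9`); est. `2.1` kernel-s. [cite: MontgomeryVaughan2007, §11.2.1 Exercises 7 (g), 8] -/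
theorem noRealZeroOdd_fp_14392 :
    ∀ χ : DirichletCharacter ℂ 14392, χ.IsQuadratic → χ.IsPrimitive → χ.Odd →
      ∀ σ : ℝ, 0 < σ → σ < 1 → χ.LFunction σ ≠ 0 :=
  good_odd_of_eight_blk [7, 257] (by norm_num) (by decide) (by decide) 15 3 44 9 (by decide) (by decide) (by decide)
    (Or.inl (by decide +kernel)) (Or.inr (by decide +kernel))

set_option maxHeartbeats 400000 in
/-- `D = -14411`: the odd character `(·/14411)` of conductor `14411` (`14411`: prime) — Fekete–Pólya witness of order `2` along the induced modulus `14411·11 = 158521`, block certificate (digits of `26` bits, splitting depth `8`); est. `1.6` kernel-s. [cite: MontgomeryVaughan2007, §11.2.1 Exercises 7 (g), 8] -/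
theorem noRealZeroOdd_fp_14411 :
    ∀ χ : DirichletCharacter ℂ 14411, χ.IsQuadratic → χ.IsPrimitive → χ.Odd →
      ∀ σ : ℝ, 0 < σ → σ < 1 → χ.LFunction σ ≠ 0 :=
  good_odd_of_odd_blk [14411] (by norm_num) (by decide) (by decide) 11 2 26 8 (by decide) (by decide) (by decide)
    (Or.inr (by decide +kernel))

set_option maxHeartbeats 400000 in
/-- `D = 14428`: the even character `χ₋₄·(·/3607)` of conductor `14428` (`3607`: prime) — Fekete–Pólya witness of order `4` along the induced modulus `14428·11 = 158708`, block certificate (digits of `56` bits, splitting depth `9`); est. `2.3` kernel-s. [cite: MontgomeryVaughan2007, §11.2.1 Exercises 7 (g), 8] -/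
theorem noRealZeroEven_fp_14428 :
    ∀ χ : DirichletCharacter ℂ 14428, χ.IsQuadratic → χ.IsPrimitive → χ.Even →
      ∀ σ : ℝ, 0 < σ → σ < 1 → χ.LFunction σ ≠ 0 :=
  good_even_of_four_blk [3607] (by norm_num) (by decide) (by decide) 11 4 56 9 (by decide) (by decide) (by decide)
    (Or.inr (by decide +kernel))

set_option maxHeartbeats 400000 in
/-- `D = -14484`: the odd character `χ₋₄·(·/3621)` of conductor `14484` (`3621`: 3 · 17 · 71) — Fekete–Pólya witness of order `7` along the induced modulus `14484·13 = 188292`, block certificate (digits of `104` bits, splitting depth `10`); est. `6.8` kernel-s. [cite: MontgomeryVaughan2007, §11.2.1 Exercises 7 (g), 8] -/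
theorem noRealZeroOdd_fp_14484 :
    ∀ χ : DirichletCharacter ℂ 14484, χ.IsQuadratic → χ.IsPrimitive → χ.Odd →
      ∀ σ : ℝ, 0 < σ → σ < 1 → χ.LFunction σ ≠ 0 :=
  good_odd_of_four_blk [3, 17, 71] (by norm_num) (by decide) (by decide) 13 7 104 10 (by decide) (by decide) (by decide)
    (Or.inr (by decide +kernel))

set_option maxHeartbeats 400000 in
/-- `D = 14489`: the even character `(·/14489)` of conductor `14489` (`14489`: prime) — Fekete–Pólya witness of order `6` along the induced modulus `14489·21 = 304269`, block certificate (digits of `92` bits, splitting depth `11`); est. `9.8` kernel-s. [cite: MontgomeryVaughan2007, §11.2.1 Exercises 7 (g), 8] -/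
theorem noRealZeroEven_fp_14489 :
    ∀ χ : DirichletCharacter ℂ 14489, χ.IsQuadratic → χ.IsPrimitive → χ.Even →
      ∀ σ : ℝ, 0 < σ → σ < 1 → χ.LFunction σ ≠ 0 :=
  good_even_of_odd_blk [14489] (by norm_num) (by decide) (by decide) 21 6 92 11 (by decide) (by decide) (by decide)
    (Or.inr (by decide +kernel))

set_option maxHeartbeats 400000 in
/-- `D = -14491`: the odd character `(·/14491)` of conductor `14491` (`14491`: 43 · 337) — Fekete–Pólya witness of order `6` along the induced modulus `14491·14 = 202874`, block certificate (digits of `90` bits, splitting depth `10`); est. `6.0` kernel-s. [cite: MontgomeryVaughan2007, §11.2.1 Exercises 7 (g), 8] -/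
theorem noRealZeroOdd_fp_14491 :
    ∀ χ : DirichletCharacter ℂ 14491, χ.IsQuadratic → χ.IsPrimitive → χ.Odd →
      ∀ σ : ℝ, 0 < σ → σ < 1 → χ.LFunction σ ≠ 0 :=
  good_odd_of_odd_blk [43, 337] (by norm_num) (by decide) (by decide) 14 6 90 10 (by decide) (by decide) (by decide)
    (Or.inr (by decide +kernel))

set_option maxHeartbeats 400000 in
/-- `D = -14515`: the odd character `(·/14515)` of conductor `14515` (`14515`: 5 · 2903) — Fekete–Pólya witness of order `6` along the induced modulus `14515·14 = 203210`, block certificate (digits of `90` bits, splitting depth `10`); est. `6.1` kernel-s. [cite: MontgomeryVaughan2007, §11.2.1 Exercises 7 (g), 8] -/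
theorem noRealZeroOdd_fp_14515 :
    ∀ χ : DirichletCharacter ℂ 14515, χ.IsQuadratic → χ.IsPrimitive → χ.Odd →
      ∀ σ : ℝ, 0 < σ → σ < 1 → χ.LFunction σ ≠ 0 :=
  good_odd_of_odd_blk [5, 2903] (by norm_num) (by decide) (by decide) 14 6 90 10 (by decide) (by decide) (by decide)
    (Or.inr (by decide +kernel))

set_option maxHeartbeats 400000 in
/-- `D = 14581`: the even character `(·/14581)` of conductor `14581` (`14581`: 7 · 2083) — Fekete–Pólya witness of order `3` along the induced modulus `14581·11 = 160391`, block certificate (digits of `40` bits, splitting depth `9`); est. `1.7` kernel-s. [cite: MontgomeryVaughan2007, §11.2.1 Exercises 7 (g), 8] -/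
theorem noRealZeroEven_fp_14581 :
    ∀ χ : DirichletCharacter ℂ 14581, χ.IsQuadratic → χ.IsPrimitive → χ.Even →
      ∀ σ : ℝ, 0 < σ → σ < 1 → χ.LFunction σ ≠ 0 :=
  good_even_of_odd_blk [7, 2083] (by norm_num) (by decide) (by decide) 11 3 40 9 (by decide) (by decide) (by decide)
    (Or.inr (by decide +kernel))

set_option maxHeartbeats 400000 in
/-- `D = -14635`: the odd character `(·/14635)` of conductor `14635` (`14635`: 5 · 2927) — Fekete–Pólya witness of order `6` along the induced modulus `14635·11 = 160985`, block certificate (digits of `87` bits, splitting depth `10`); est. `4.9` kernel-s. [cite: MontgomeryVaughan2007, §11.2.1 Exercises 7 (g), 8] -/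
theorem noRealZeroOdd_fp_14635 :
    ∀ χ : DirichletCharacter ℂ 14635, χ.IsQuadratic → χ.IsPrimitive → χ.Odd →
      ∀ σ : ℝ, 0 < σ → σ < 1 → χ.LFunction σ ≠ 0 :=
  good_odd_of_odd_blk [5, 2927] (by norm_num) (by decide) (by decide) 11 6 87 10 (by decide) (by decide) (by decide)
    (Or.inr (by decide +kernel))

set_option maxHeartbeats 400000 in
/-- `D = -14903`: the odd character `(·/14903)` of conductor `14903` (`14903`: 7 · 2129) — Fekete–Pólya witness of order `6` along the induced modulus `14903·11 = 163933`, block certificate (digits of `89` bits, splitting depth `10`); est. `5.0` kernel-s. [cite: MontgomeryVaughan2007, §11.2.1 Exercises 7 (g), 8] -/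
theorem noRealZeroOdd_fp_14903 :
    ∀ χ : DirichletCharacter ℂ 14903, χ.IsQuadratic → χ.IsPrimitive → χ.Odd →
      ∀ σ : ℝ, 0 < σ → σ < 1 → χ.LFunction σ ≠ 0 :=
  good_odd_of_odd_blk [7, 2129] (by norm_num) (by decide) (by decide) 11 6 89 10 (by decide) (by decide) (by decide)
    (Or.inr (by decide +kernel))

set_option maxHeartbeats 400000 in
/-- `D = -14968`: the odd character `χ₈·(·/1871)` of conductor `14968` (`1871`: prime) — Fekete–Pólya witness of order `4` along the induced modulus `14968·15 = 224520`, block certificate (digits of `60` bits, splitting depth `9`); est. `3.1` kernel-s. [cite: MontgomeryVaughan2007, §11.2.1 Exercises 7 (g), 8] -/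
theorem noRealZeroOdd_fp_14968 :
    ∀ χ : DirichletCharacter ℂ 14968, χ.IsQuadratic → χ.IsPrimitive → χ.Odd →
      ∀ σ : ℝ, 0 < σ → σ < 1 → χ.LFunction σ ≠ 0 :=
  good_odd_of_eight_blk [1871] (by norm_num) (by decide) (by decide) 15 4 60 9 (by decide) (by decide) (by decide)
    (Or.inl (by decide +kernel)) (Or.inr (by decide +kernel))

set_option maxHeartbeats 400000 in
/-- `D = 15032`: the even character `χ₋₈·(·/1879)` of conductor `15032` (`1879`: prime) — Fekete–Pólya witness of order `3` along the induced modulus `15032·15 = 225480`, block certificate (digits of `41` bits, splitting depth `9`); est. `2.2` kernel-s. [cite: MontgomeryVaughan2007, §11.2.1 Exercises 7 (g), 8] -/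
theorem noRealZeroEven_fp_15032 :
    ∀ χ : DirichletCharacter ℂ 15032, χ.IsQuadratic → χ.IsPrimitive → χ.Even →
      ∀ σ : ℝ, 0 < σ → σ < 1 → χ.LFunction σ ≠ 0 :=
  good_even_of_eight_blk [1879] (by norm_num) (by decide) (by decide) 15 3 41 9 (by decide) (by decide) (by decide)
    (Or.inr (by decide +kernel)) (Or.inl (by decide +kernel))

set_option maxHeartbeats 400000 in
/-- `D = 15036`: the even character `χ₋₄·(·/3759)` of conductor `15036` (`3759`: 3 · 7 · 179) — Fekete–Pólya witness of order `3` along the induced modulus `15036·11 = 165396`, block certificate (digits of `40` bits, splitting depth `9`); est. `1.6` kernel-s. [cite: MontgomeryVaughan2007, §11.2.1 Exercises 7 (g), 8] -/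
theorem noRealZeroEven_fp_15036 :
    ∀ χ : DirichletCharacter ℂ 15036, χ.IsQuadratic → χ.IsPrimitive → χ.Even →
      ∀ σ : ℝ, 0 < σ → σ < 1 → χ.LFunction σ ≠ 0 :=
  good_even_of_four_blk [3, 7, 179] (by norm_num) (by decide) (by decide) 11 3 40 9 (by decide) (by decide) (by decide)
    (Or.inr (by decide +kernel))

set_option maxHeartbeats 400000 in
/-- `D = 15053`: the even character `(·/15053)` of conductor `15053` (`15053`: prime) — Fekete–Pólya witness of order `7` along the induced modulus `15053·15 = 225795`, block certificate (digits of `104` bits, splitting depth `10`); est. `9.0` kernel-s. [cite: MontgomeryVaughan2007, §11.2.1 Exercises 7 (g), 8] -/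
theorem noRealZeroEven_fp_15053 :
    ∀ χ : DirichletCharacter ℂ 15053, χ.IsQuadratic → χ.IsPrimitive → χ.Even →
      ∀ σ : ℝ, 0 < σ → σ < 1 → χ.LFunction σ ≠ 0 :=
  good_even_of_odd_blk [15053] (by norm_num) (by decide) (by decide) 15 7 104 10 (by decide) (by decide) (by decide)
    (Or.inr (by decide +kernel))

end Literature.NumberTheory.LFunctions
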